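import Summits.Ventures.HodgeRepro2.WeilDetect
import Mathlib.LinearAlgebra.TensorProduct.Graded.Internal

/-!
# The coproduct model of `H^*(B × B, ℂ)` and Proposition A5.5 (A3, seat p5)

`H^*(B × B, ℂ) ≅ H^*(B, ℂ) ⊗ H^*(B, ℂ)` with the Koszul sign rule (Künneth, T4-A3 (A5.0)) is modelled by
Mathlib's graded tensor product `𝒜 ᵍ⊗[ℂ] 𝒜` of the exterior algebra `A ι` with itself (ℕ-grading by
exterior powers).  The pull-back `m^*` along the addition of the torus is the algebra homomorphism
`cop` with `cop (ι v) = ι v ⊗ 1 + 1 ⊗ ι v` (T4-A3 (A5.1.1), Hatcher §3.C), and `∫_{B×B} := ∫_B ⊗ ∫_B`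
(T4-A3 (A5.2.0), Bredon Thm. 5.4 — here by construction).
-/

open scoped TensorProduct

namespace Summit.Ventures.HodgeRepro2.WeilCoproduct

open Summit.Ventures.HodgeRepro2.WeilPlanes Summit.Ventures.HodgeRepro2.WeilIntegral
  Summit.Ventures.HodgeRepro2.WeilDetect

variable {ι : Type*} [DecidableEq ι]

/-- The ℕ-grading of the model by exterior powers. -/
abbrev grading (ι : Type*) [DecidableEq ι] : ℕ → Submodule ℂ (A ι) := fun n => ⋀[ℂ]^n (V ι)

/-- The model of `H^*(B × B, ℂ)`: the graded tensor product of the model with itself. -/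
abbrev AA (ι : Type*) [DecidableEq ι] := grading ι ᵍ⊗[ℂ] grading ι

/-- `pr_1^* : x ↦ x ⊗ 1`. -/
noncomputable def inl : A ι →ₐ[ℂ] AA ι := GradedTensorProduct.includeLeft (grading ι) (grading ι)

/-- `pr_2^* : y ↦ 1 ⊗ y`. -/
noncomputable def inr : A ι →ₐ[ℂ] AA ι := GradedTensorProduct.includeRight (grading ι) (grading ι)

/-- `inl x = x ⊗ 1`. -/
theorem inl_apply (x : A ι) : inl x = (x ᵍ⊗ₜ[ℂ] (1 : A ι) : AA ι) := rfl

/-- `inr y = 1 ⊗ y`. -/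
theorem inr_apply (y : A ι) : inr y = ((1 : A ι) ᵍ⊗ₜ[ℂ] y : AA ι) := rfl

/-- `(x ⊗ 1)(1 ⊗ y) = x ⊗ y` (no sign). -/
theorem inl_mul_inr (x y : A ι) : inl x * inr y = (x ᵍ⊗ₜ[ℂ] y : AA ι) :=
  GradedTensorProduct.tmul_one_mul_one_tmul _ _ x y

/-- Generators lie in degree one. -/
theorem ι_mem_one (v : V ι) : ExteriorAlgebra.ι ℂ v ∈ grading ι 1 := by
  simpa only [grading, pow_one] using LinearMap.mem_range_self (ExteriorAlgebra.ι ℂ) v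

/-- `E p` lies in degree two. -/
theorem E_mem_two (p : ι) : E p ∈ grading ι 2 :=
  SetLike.mul_mem_graded (ι_mem_one _) (ι_mem_one _)

/-- `(1 ⊗ ι v)(ι w ⊗ 1) = −(ι w ⊗ ι v)`: the Koszul sign for two degree-one elements. -/
theorem inr_ι_mul_inl_ι (v w : V ι) :
    inr (ExteriorAlgebra.ι ℂ v) * inl (ExteriorAlgebra.ι ℂ w) =
      -(inl (ExteriorAlgebra.ι ℂ w) * inr (ExteriorAlgebra.ι ℂ v)) := by
  rw [inl_mul_inr, inr_apply, inl_apply]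
  have := GradedTensorProduct.tmul_coe_mul_coe_tmul (grading ι) (grading ι) (1 : A ι)
    (⟨ExteriorAlgebra.ι ℂ v, ι_mem_one v⟩ : grading ι 1) (⟨ExteriorAlgebra.ι ℂ w, ι_mem_one w⟩ : grading ι 1)
    (1 : A ι)
  simp only [one_mul, mul_one] at this
  rw [this]
  simp

/-- `(−1)^2 = 1` for the `ℕ`-power of `ℤˣ` used by the graded tensor product's sign rule. -/
theorem neg_one_uzpow_two : (@HPow.hPow ℤˣ ℕ ℤˣ (@instHPow ℤˣ ℕ Int.instUnitsPow) (-1 : ℤˣ) 2) = 1 := by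
  decide

/-- `(1 ⊗ E p)(ι w ⊗ 1) = ι w ⊗ E p`: an even element on the right moves past a generator freely. -/
theorem inr_E_mul_inl_ι (p : ι) (w : V ι) :
    inr (E p) * inl (ExteriorAlgebra.ι ℂ w) = inl (ExteriorAlgebra.ι ℂ w) * inr (E p) := by
  rw [inl_mul_inr, inr_apply, inl_apply]
  have := GradedTensorProduct.tmul_coe_mul_coe_tmul (grading ι) (grading ι) (1 : A ι)
    (⟨E p, E_mem_two p⟩ : grading ι 2) (⟨ExteriorAlgebra.ι ℂ w, ι_mem_one w⟩ : grading ι 1)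
    (1 : A ι)
  simp only [one_mul, mul_one] at this
  rw [this, neg_one_uzpow_two, one_smul]

/-- `(1 ⊗ ι v)(E p ⊗ 1) = E p ⊗ ι v`. -/
theorem inr_ι_mul_inl_E (v : V ι) (p : ι) :
    inr (ExteriorAlgebra.ι ℂ v) * inl (E p) = inl (E p) * inr (ExteriorAlgebra.ι ℂ v) := by
  rw [inl_mul_inr, inr_apply, inl_apply]
  have := GradedTensorProduct.tmul_coe_mul_coe_tmul (grading ι) (grading ι) (1 : A ι)
    (⟨ExteriorAlgebra.ι ℂ v, ι_mem_one v⟩ : grading ι 1) (⟨E p, E_mem_two p⟩ : grading ι 2)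
    (1 : A ι)
  simp only [one_mul, mul_one] at this
  rw [this, neg_one_uzpow_two, one_smul]

/-- Every element of `AA ι` is a sum of tensors `x ⊗ y`: induction principle. -/
theorem AA_induction {motive : AA ι → Prop} (zero : motive 0)
    (tmul : ∀ x y : A ι, motive (x ᵍ⊗ₜ[ℂ] y)) (add : ∀ Z Z', motive Z → motive Z' → motive (Z + Z'))
    (Z : AA ι) : motive Z := by
  have : Z = GradedTensorProduct.of ℂ (grading ι) (grading ι)
      ((GradedTensorProduct.of ℂ (grading ι) (grading ι)).symm Z) := rfl
  rw [this]
  induction (GradedTensorProduct.of ℂ (grading ι) (grading ι)).symm Z using TensorProduct.induction_on with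
  | zero => simpa using zero
  | tmul x y => exact tmul x y
  | add a b ha hb => simpa using add _ _ ha hb

/-- `1 ⊗ E p` is central in `AA ι`. -/
theorem commute_inr_E (p : ι) (Z : AA ι) : Commute (inr (E p)) Z := by
  induction Z using AA_induction with
  | zero => exact Commute.zero_right _
  | tmul x y =>
    rw [← inl_mul_inr]
    refine Commute.mul_right ?_ ?_
    · -- commute with `x ⊗ 1` by induction on `x`
      induction x using ExteriorAlgebra.induction with
      | algebraMap r => rw [AlgHom.commutes]; exact Algebra.commute_algebraMap_right r _
      | ι v => exact inr_E_mul_inl_ι p v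
      | mul a b ha hb => rw [map_mul]; exact ha.mul_right hb
      | add a b ha hb => rw [map_add]; exact ha.add_right hb
    · exact (commute_E p y).map inr
  | add Z Z' hZ hZ' => exact hZ.add_right hZ'

/-- `E p ⊗ 1` is central in `AA ι`. -/
theorem commute_inl_E (p : ι) (Z : AA ι) : Commute (inl (E p)) Z := by
  induction Z using AA_induction with
  | zero => exact Commute.zero_right _
  | tmul x y =>
    rw [← inl_mul_inr]
    refine Commute.mul_right ?_ ?_
    · exact (commute_E p x).map inl
    · induction y using ExteriorAlgebra.induction with
      | algebraMap r => rw [AlgHom.commutes]; exact Algebra.commute_algebraMap_right r _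
      | ι v => exact (inr_ι_mul_inl_E v p).symm
      | mul a b ha hb => rw [map_mul]; exact ha.mul_right hb
      | add a b ha hb => rw [map_add]; exact ha.add_right hb
  | add Z Z' hZ hZ' => exact hZ.add_right hZ'

/-! ## 2. Products with tensors; the coproduct `cop` -/

/-- `(x' ⊗ 1)(x ⊗ y) = (x' x) ⊗ y` for all `x` (no sign: `1` has degree `0`). -/
theorem inl_mul_tmul (x' x y : A ι) : inl x' * (x ᵍ⊗ₜ[ℂ] y : AA ι) = ((x' * x) ᵍ⊗ₜ[ℂ] y : AA ι) := by
  induction x using DirectSum.Decomposition.inductionOn (ℳ := grading ι) with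
  | zero => simp [GradedTensorProduct.tmul]
  | homogeneous m =>
    rw [inl_apply]
    exact GradedTensorProduct.tmul_one_mul_coe_tmul (grading ι) (grading ι) x' m y
  | add m m' hm hm' =>
    simp only [GradedTensorProduct.tmul, TensorProduct.add_tmul, map_add, mul_add, hm, hm']

/-- `(x ⊗ y)(1 ⊗ y') = x ⊗ (y y')` for all `y`. -/
theorem tmul_mul_inr (x y y' : A ι) : (x ᵍ⊗ₜ[ℂ] y : AA ι) * inr y' = (x ᵍ⊗ₜ[ℂ] (y * y') : AA ι) := by
  induction y using DirectSum.Decomposition.inductionOn (ℳ := grading ι) with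
  | zero => simp [GradedTensorProduct.tmul]
  | homogeneous m =>
    rw [inr_apply]
    exact GradedTensorProduct.tmul_coe_mul_one_tmul (grading ι) (grading ι) x m y'
  | add m m' hm hm' =>
    simp only [GradedTensorProduct.tmul, TensorProduct.tmul_add, map_add, add_mul, hm, hm']

/-- `(1 ⊗ E p)(x ⊗ y) = x ⊗ (E p y)`: the even central element moves to the right factor. -/
theorem inr_E_mul_tmul (p : ι) (x y : A ι) :
    inr (E p) * (x ᵍ⊗ₜ[ℂ] y : AA ι) = (x ᵍ⊗ₜ[ℂ] (E p * y) : AA ι) := by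
  rw [(commute_inr_E p _).eq, tmul_mul_inr, (commute_E p y).eq]

/-- `(1 ⊗ E_T)(x ⊗ y) = x ⊗ (E_T y)`. -/
theorem inr_ET_mul_tmul (T : Finset ι) (x y : A ι) :
    inr (ET T) * (x ᵍ⊗ₜ[ℂ] y : AA ι) = (x ᵍ⊗ₜ[ℂ] (ET T * y) : AA ι) := by
  induction T using Finset.induction_on generalizing y with
  | empty => simp
  | insert p T hp ih =>
    rw [ET_insert hp, map_mul, mul_assoc, ih, inr_E_mul_tmul, mul_assoc]

/-- `(1 ⊗ θ^r)(x ⊗ y) = x ⊗ (θ^r y)`. -/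
theorem inr_theta_pow_mul_tmul [Fintype ι] (c : ι → ℂ) (r : ℕ) (x y : A ι) :
    inr (theta c ^ r) * (x ᵍ⊗ₜ[ℂ] y : AA ι) = (x ᵍ⊗ₜ[ℂ] (theta c ^ r * y) : AA ι) := by
  rw [theta_pow, map_smul, map_sum, smul_mul_assoc, Finset.sum_mul, smul_mul_assoc, Finset.sum_mul]
  simp only [map_smul, smul_mul_assoc, inr_ET_mul_tmul, GradedTensorProduct.tmul,
    TensorProduct.tmul_smul, TensorProduct.tmul_sum, map_sum]

/-- `(1 ⊗ gen k)(x ⊗ y)` lies in the span of the tensors `x' ⊗ (gen k y)`. -/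
theorem inr_gen_mul_tmul_mem (k : Gen ι) (x y : A ι) :
    inr (gen k) * (x ᵍ⊗ₜ[ℂ] y : AA ι) ∈
      Submodule.span ℂ (Set.range fun x' : A ι => (x' ᵍ⊗ₜ[ℂ] (gen k * y) : AA ι)) := by
  induction x using DirectSum.Decomposition.inductionOn (ℳ := grading ι) with
  | zero => simp [GradedTensorProduct.tmul]
  | homogeneous m =>
    -- `(1 ⊗ gen k)(m ⊗ 1)(1 ⊗ y) = ± (m ⊗ gen k)(1 ⊗ y) = ± m ⊗ (gen k y)`
    have h1 : (m : A ι) ᵍ⊗ₜ[ℂ] y = ((m : A ι) ᵍ⊗ₜ[ℂ] (1 : A ι) : AA ι) * inr y := by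
      rw [tmul_mul_inr, one_mul]
    have h2 := GradedTensorProduct.tmul_coe_mul_coe_tmul (grading ι) (grading ι) (1 : A ι)
      (⟨gen k, ι_mem_one _⟩ : grading ι 1) m (1 : A ι)
    simp only [one_mul, mul_one] at h2
    rw [h1, ← mul_assoc, inr_apply, h2, smul_mul_assoc, tmul_mul_inr]
    exact Submodule.smul_mem _ _ (Submodule.subset_span (Set.mem_range_self (m : A ι)))
  | add m m' hm hm' =>
    simp only [GradedTensorProduct.tmul, TensorProduct.add_tmul, map_add, mul_add]
    exact Submodule.add_mem _ hm hm'

/-- `(1 ⊗ gen j)(gen k ⊗ 1) = −(gen k ⊗ 1)(1 ⊗ gen j)`. -/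
theorem inr_gen_mul_inl_gen (j k : Gen ι) : inr (gen j) * inl (gen k) = -(inl (gen k) * inr (gen j)) :=
  inr_ι_mul_inl_ι _ _

/-- The defining map of the coproduct squares to zero. -/
theorem coproductMap_sq (v : V ι) :
    (inl (ExteriorAlgebra.ι ℂ v) + inr (ExteriorAlgebra.ι ℂ v)) *
      (inl (ExteriorAlgebra.ι ℂ v) + inr (ExteriorAlgebra.ι ℂ v)) = 0 := by
  have h1 : inl (ExteriorAlgebra.ι ℂ v) * inl (ExteriorAlgebra.ι ℂ v) = 0 := by
    rw [← map_mul inl, ExteriorAlgebra.ι_sq_zero, map_zero]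
  have h2 : inr (ExteriorAlgebra.ι ℂ v) * inr (ExteriorAlgebra.ι ℂ v) = 0 := by
    rw [← map_mul inr, ExteriorAlgebra.ι_sq_zero, map_zero]
  rw [add_mul, mul_add, mul_add, h1, h2, inr_ι_mul_inl_ι]
  abel

/-- The defining map of the coproduct, as a square-zero linear map `V → AA`. -/
noncomputable def coproductMap : {f : V ι →ₗ[ℂ] AA ι // ∀ m, f m * f m = 0} :=
  ⟨inl.toLinearMap ∘ₗ ExteriorAlgebra.ι ℂ + inr.toLinearMap ∘ₗ ExteriorAlgebra.ι ℂ, fun v => by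
    simp only [LinearMap.add_apply, LinearMap.comp_apply, AlgHom.toLinearMap_apply]
    exact coproductMap_sq v⟩

/-- The coproduct `cop` (Δ in the prose): `cop : H^*(B) → H^*(B) ⊗ H^*(B)`, `Δ(v) = v ⊗ 1 + 1 ⊗ v` on `H^1` (the model of the
pull-back `m^*` along the addition `m : B × B → B`, T4-A3 (A5.1.1)); an algebra homomorphism. -/
noncomputable def cop : A ι →ₐ[ℂ] AA ι := ExteriorAlgebra.lift ℂ coproductMap

/-- `cop (ι v) = ι v ⊗ 1 + 1 ⊗ ι v`. -/
theorem cop_ι (v : V ι) : cop (ExteriorAlgebra.ι ℂ v) = inl (ExteriorAlgebra.ι ℂ v) + inr (ExteriorAlgebra.ι ℂ v) := by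
  simp [cop, coproductMap, ExteriorAlgebra.lift_ι_apply]

/-- `cop (gen j) = gen j ⊗ 1 + 1 ⊗ gen j`. -/
theorem cop_gen (j : Gen ι) : cop (gen j) = inl (gen j) + inr (gen j) := cop_ι _

/-- `cop (E p) = 1 ⊗ E p + (E p ⊗ 1 + (a_p ⊗ 1)(1 ⊗ b_p) − (b_p ⊗ 1)(1 ⊗ a_p))` (T4-A3 A5.5 Step 2). -/
theorem cop_E (p : ι) :
    cop (E p) = inr (E p) + (inl (E p) + inl (gen (p, false)) * inr (gen (p, true)) -
      inl (gen (p, true)) * inr (gen (p, false))) := by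
  have h1 : inl (gen (p, false)) * inl (gen (p, true)) = inl (E p) := (map_mul inl _ _).symm
  have h2 : inr (gen (p, false)) * inr (gen (p, true)) = inr (E p) := (map_mul inr _ _).symm
  rw [show cop (E p) = cop (gen (p, false) * gen (p, true)) from rfl, map_mul, cop_gen, cop_gen, add_mul,
    mul_add, mul_add, h1, h2, inr_gen_mul_inl_gen]
  abel

end Summit.Ventures.HodgeRepro2.WeilCoproduct
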